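import Literature.MathematicalPhysics.QuantumFieldTheory.StrongCouplingLeadingCoefficient
import HarnessLib

/-!
# Crux `NT` (stmt-QuantumFields-19353), strong-coupling rung: the THREE-REPLICA expansion of the third cumulant —
# objects and basic bookkeeping

Definition helper file of the fleet lead prover of crux `NT` (unit `ym-spine-19353-p1`, g25), the first layer of the
missing piece named by g24 (SIZING-19353-g24 §4) under the plan-only rung R1/R2 of LINE φ
(`Cruxes/NT/Lines/slab_response_fh_rung.lean`: `c β⁷ ≤ torusK3(dens₋ₑ₀, dens₊ₑ₀, dens₀)`): a CONNECTED strong-coupling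
expansion of the third cumulant of three plaquette observables, free of the pair hypotheses (H1p)/(H1q) of
`…ProductObsCumulant.thirdCumulant_sub_leading_le` (which fail for the `2×1×1`-box triples and are useless for the
nine «membrane» triples `(a, S@e₀, S@0)` whose every pairing is adjacent).

The device is the tree's replica method (`Literature…StrongCouplingReplica`, Osterwalder–Seiler 1978 §3) with THREE
independent copies `U⁰, U¹, U²` of the configuration instead of two:

  `κ₃(X, Y, Z) = E_{ν⊗ν⊗ν}[(X(U⁰) − X(U¹)) (Y(U⁰) − Y(U²)) (Z(U⁰) − Z(U¹))]`

(the pairs `(0,1), (0,2), (0,1)`: the only replica common to the three differences is `0`, which is what makes the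
leading coefficient exactly `κ(T₀)`; a kernel with the same pair three times has expectation `0`).  The tripled
Gibbs factor `W̃(U⁰)W̃(U¹)W̃(U²) = ∏_p (1 + h_p)`, `h_p = ∏ᵢ (1 + f̃_p(Uⁱ)) − 1` (`triActivity`), expands over plaquette
sets `Q ⊆ Λ'` into the terms `I₃(Q) = ∫ K · ∏_{p ∈ Q} h_p d(ν⊗ν⊗ν)` (`triExpansionTerm`).

This file: the tripled configuration space `TriConfig d G = (ZdEdge d × Fin 3) → G` with its product Haar measure
`triHaar` (ONE `Measure.infinitePi`, so `Literature…ProductMeasureTools` applies), the replicas `TriConfig.rep i`, their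
laws and independence (`map_rep_triHaar`, `integral_rep_mul_rep_mul_rep`), the tripled activity with its uniform bound,
support and ZERO MEAN over the three copies of each of its bonds (`integral_mul_triActivity_eq_zero`), the kernel
`triKernel`, the product `triActivityProd`, the term `triExpansionTerm` and the tripled Gibbs factor `triGibbs` with
measurability / bound / support bookkeeping.  General `d`, compact `G`, continuous unitary-matrix `ρ`.

HONEST FRAMING: definitions and product-measure bookkeeping; nothing about `β → ∞`, NT or the gap.
References: K. Osterwalder, E. Seiler, Ann. Phys. 110 (1978) 440, §3 (Remark (3.9), proof of Thm. 3.5)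
[OsterwalderSeilerAnnPhys1978]; G. Münster, Nucl. Phys. B 180 (1981) 23, §2 [Munster1981]; I. Montvay, G. Münster,
Quantum Fields on a Lattice (1994) §3.4 [MontvayMunster1994].
-/

set_option autoImplicit false

noncomputable section

open MeasureTheory Measure ProbabilityTheory
open Literature.MathematicalPhysics.QuantumFieldTheory
open Literature.MathematicalPhysics.QuantumLattice (ZdPlaquette plaquetteEdges)

namespace Summit.QuantumFields.YangMills.Cruxes.NT.StrongCouplingRung

/-! ## §1 The tripled configuration space and the three replicas -/

/-- Tripled bond set: three copies of every bond of `ℤ^d`. [folklore] -/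
abbrev TriEdge (d : ℕ) : Type := ZdEdge d × Fin 3

/-- Tripled (three-replica) configurations: a group element on every bond of each copy. [folklore] -/
abbrev TriConfig (d : ℕ) (G : Type*) : Type _ := TriEdge d → G

namespace TriConfig

variable {d : ℕ} {G : Type*}

/-- The `i`-th replica `Uⁱ = W(·, i)`. [folklore] -/
def rep (i : Fin 3) (W : TriConfig d G) : ZdGaugeConfig d G := fun e => W (e, i)

/-- `rep i W e = W (e, i)`. [folklore] -/
@[simp] theorem rep_apply (i : Fin 3) (W : TriConfig d G) (e : ZdEdge d) : rep i W e = W (e, i) := rfl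

/-- Updating the bond `(ℓ, i)` updates the `i`-th replica at `ℓ`. [folklore] -/
theorem rep_update_same [DecidableEq (ZdEdge d)] (i : Fin 3) (W : TriConfig d G) (ℓ : ZdEdge d) (g : G) :
    rep i (Function.update W (ℓ, i) g) = Function.update (rep i W) ℓ g := by
  ext e
  by_cases h : e = ℓ
  · subst h; simp [rep]
  · rw [Function.update_of_ne h]; simp [rep, h]

/-- Updating the bond `(ℓ, j)`, `j ≠ i`, does not change the `i`-th replica. [folklore] -/
theorem rep_update_ne [DecidableEq (ZdEdge d)] {i j : Fin 3} (hij : i ≠ j) (W : TriConfig d G) (ℓ : ZdEdge d)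
    (g : G) : rep i (Function.update W (ℓ, j) g) = rep i W := by
  ext e
  have : ((e, i) : TriEdge d) ≠ (ℓ, j) := fun h => hij (Prod.ext_iff.1 h).2
  simp [rep, Function.update_of_ne this]

/-- `rep i` is measurable. [folklore] -/
theorem measurable_rep [MeasurableSpace G] (i : Fin 3) :
    Measurable (rep i : TriConfig d G → ZdGaugeConfig d G) :=
  measurable_pi_lambda _ fun _ => measurable_pi_apply _

/-- A function of the `i`-th replica depending on the bonds `E` depends on `E × {i}`. [folklore] -/
theorem dependsOn_comp_rep {α : Type*} (i : Fin 3) {F : ZdGaugeConfig d G → α} {E : Finset (ZdEdge d)}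
    (hF : DependsOn F (E : Set (ZdEdge d))) :
    DependsOn (fun W : TriConfig d G => F (rep i W))
      ((E ×ˢ ({i} : Finset (Fin 3)) : Finset (TriEdge d)) : Set (TriEdge d)) :=
  fun _ _ h => hF fun e he => h (e, i)
    (Finset.mem_coe.2 (Finset.mem_product.2 ⟨Finset.mem_coe.1 he, Finset.mem_singleton_self _⟩))

/-- A function of the `i`-th replica depending on the bond SET `E` depends on the tripled bonds over `E`. [folklore] -/
theorem dependsOn_comp_rep_set {α : Type*} (i : Fin 3) {F : ZdGaugeConfig d G → α} {E : Set (ZdEdge d)}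
    (hF : DependsOn F E) : DependsOn (fun W : TriConfig d G => F (rep i W)) {e : TriEdge d | e.1 ∈ E} :=
  fun _ _ h => hF fun e he => h (e, i) he

end TriConfig

/-! ## §2 The tripled product Haar measure; laws and independence of the replicas -/

section Measure

variable {d : ℕ} {G : Type*} [Group G] [TopologicalSpace G] [IsTopologicalGroup G]
  [CompactSpace G] [MeasurableSpace G] [BorelSpace G]

variable (d G) in
/-- The tripled product Haar measure `dg_∞ ⊗ dg_∞ ⊗ dg_∞`, realised as one product over `TriEdge d` (an `abbrev`, so
that the probability-measure instance of `Measure.infinitePi` is found through it). [folklore] -/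
abbrev triHaar : Measure (TriConfig d G) := infinitePi fun _ : TriEdge d => haarProbability G

/-- `triHaar` is a probability measure (instance search sees through the abbreviation). [folklore] -/
theorem isProbabilityMeasure_triHaar : IsProbabilityMeasure (triHaar d G) := inferInstance

/-- Each replica is `dg_∞`-distributed. [folklore] -/
theorem map_rep_triHaar (i : Fin 3) : (triHaar d G).map (TriConfig.rep i) = zdHaar d G :=
  map_infinitePi_infinitePi_of_inj (P := fun _ : TriEdge d => haarProbability G)
    (f := fun e : ZdEdge d => (e, i)) (fun _ _ h => (Prod.ext_iff.1 h).1)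

/-- Integrals of functions of one replica. [folklore] -/
theorem integral_comp_rep_triHaar (i : Fin 3) {F : ZdGaugeConfig d G → ℝ}
    (hF : AEStronglyMeasurable F (zdHaar d G)) :
    ∫ W, F (TriConfig.rep i W) ∂triHaar d G = ∫ U, F U ∂zdHaar d G := by
  rw [← map_rep_triHaar (G := G) i, integral_map (TriConfig.measurable_rep i).aemeasurable]
  rwa [map_rep_triHaar]

/-- Replica factorisation for two replicas `i ≠ j`: `∫ A(Uⁱ) B(Uʲ) = ∫ A · ∫ B` for bounded measurable local
`A`, `B`. [folklore] -/
theorem integral_rep_mul_rep {i j : Fin 3} (hij : i ≠ j) {A B : ZdGaugeConfig d G → ℝ} (hAm : Measurable A)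
    (hBm : Measurable B) {EA EB : Finset (ZdEdge d)} (hA : DependsOn A (EA : Set (ZdEdge d)))
    (hB : DependsOn B (EB : Set (ZdEdge d))) :
    ∫ W, A (TriConfig.rep i W) * B (TriConfig.rep j W) ∂triHaar d G =
      (∫ U, A U ∂zdHaar d G) * ∫ U, B U ∂zdHaar d G := by
  classical
  have h := Literature.Probability.LatticeModels.integral_mul_eq_of_dependsOn_disjoint
    (fun _ : TriEdge d => haarProbability G)
    (S := EA ×ˢ ({i} : Finset (Fin 3))) (T := EB ×ˢ ({j} : Finset (Fin 3)))
    (F := fun W : TriConfig d G => A (TriConfig.rep i W)) (G := fun W : TriConfig d G => B (TriConfig.rep j W))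
    (by
      rw [Finset.disjoint_left]
      rintro ⟨e, k⟩ h1 h2
      simp only [Finset.mem_product, Finset.mem_singleton] at h1 h2
      exact hij (h1.2.symm.trans h2.2))
    (hAm.comp (TriConfig.measurable_rep i)) (hBm.comp (TriConfig.measurable_rep j))
    (TriConfig.dependsOn_comp_rep i hA) (TriConfig.dependsOn_comp_rep j hB)
  rw [h, integral_comp_rep_triHaar i hAm.aestronglyMeasurable,
    integral_comp_rep_triHaar j hBm.aestronglyMeasurable]

/-- **Replica factorisation**: `∫ A(U⁰) B(U¹) C(U²) = ∫ A · ∫ B · ∫ C` for bounded measurable local `A, B, C`.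
[folklore] -/
theorem integral_rep_mul_rep_mul_rep {A B C : ZdGaugeConfig d G → ℝ} (hAm : Measurable A) (hBm : Measurable B)
    (hCm : Measurable C) {EA EB EC : Finset (ZdEdge d)} (hA : DependsOn A (EA : Set (ZdEdge d)))
    (hB : DependsOn B (EB : Set (ZdEdge d))) (hC : DependsOn C (EC : Set (ZdEdge d))) :
    ∫ W, A (TriConfig.rep 0 W) * B (TriConfig.rep 1 W) * C (TriConfig.rep 2 W) ∂triHaar d G =
      (∫ U, A U ∂zdHaar d G) * (∫ U, B U ∂zdHaar d G) * ∫ U, C U ∂zdHaar d G := by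
  classical
  -- split off replica `0`
  have hBC_dep : DependsOn (fun W : TriConfig d G => B (TriConfig.rep 1 W) * C (TriConfig.rep 2 W))
      (((EB ×ˢ ({1} : Finset (Fin 3))) ∪ (EC ×ˢ ({2} : Finset (Fin 3))) : Finset (TriEdge d)) :
        Set (TriEdge d)) := by
    intro W W' h
    have e1 := TriConfig.dependsOn_comp_rep (G := G) 1 hB (fun e he => h e (by
      rw [Finset.coe_union]; exact Or.inl he))
    have e2 := TriConfig.dependsOn_comp_rep (G := G) 2 hC (fun e he => h e (by
      rw [Finset.coe_union]; exact Or.inr he))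
    change B (TriConfig.rep 1 W) * C (TriConfig.rep 2 W) = B (TriConfig.rep 1 W') * C (TriConfig.rep 2 W')
    simp only at e1 e2
    rw [e1, e2]
  have h := Literature.Probability.LatticeModels.integral_mul_eq_of_dependsOn_disjoint
    (fun _ : TriEdge d => haarProbability G)
    (S := EA ×ˢ ({0} : Finset (Fin 3))) (T := (EB ×ˢ ({1} : Finset (Fin 3))) ∪ (EC ×ˢ ({2} : Finset (Fin 3))))
    (F := fun W : TriConfig d G => A (TriConfig.rep 0 W))
    (G := fun W : TriConfig d G => B (TriConfig.rep 1 W) * C (TriConfig.rep 2 W))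
    (by
      rw [Finset.disjoint_left]
      rintro ⟨e, k⟩ h1 h2
      simp only [Finset.mem_product, Finset.mem_singleton, Finset.mem_union] at h1 h2
      rcases h2 with h2 | h2
      · exact absurd (h1.2.symm.trans h2.2) (by decide)
      · exact absurd (h1.2.symm.trans h2.2) (by decide))
    (hAm.comp (TriConfig.measurable_rep 0))
    ((hBm.comp (TriConfig.measurable_rep 1)).mul (hCm.comp (TriConfig.measurable_rep 2)))
    (TriConfig.dependsOn_comp_rep 0 hA) hBC_dep
  have h' : ∫ W, A (TriConfig.rep 0 W) * B (TriConfig.rep 1 W) * C (TriConfig.rep 2 W) ∂triHaar d G =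
      ∫ W, A (TriConfig.rep 0 W) * (B (TriConfig.rep 1 W) * C (TriConfig.rep 2 W)) ∂triHaar d G :=
    integral_congr_ae (ae_of_all _ fun W => by ring)
  rw [h', h, integral_comp_rep_triHaar 0 hAm.aestronglyMeasurable,
    integral_rep_mul_rep (by decide) hBm hCm hB hC, mul_assoc]

end Measure

/-! ## §3 The tripled activity: bound, support, zero mean over each bond -/

section Activity

variable {d N : ℕ} {G : Type*} [Group G] [TopologicalSpace G] [IsTopologicalGroup G]
  [CompactSpace G] [MeasurableSpace G] [BorelSpace G] (ρ : G →* Matrix (Fin N) (Fin N) ℂ)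

/-- The tripled plaquette activity `h_p(U⁰,U¹,U²) = ∏ᵢ (1 + f̃_p(Uⁱ)) − 1` of the expansion
`W̃(U⁰) W̃(U¹) W̃(U²) = ∏_p (1 + h_p)`. [folklore] -/
def triActivity (β : ℝ) (x : Literature.Probability.LatticeModels.Site d) (i j : Fin d) (W : TriConfig d G) : ℝ :=
  (1 + plaqActivity ρ β x i j (TriConfig.rep 0 W)) * (1 + plaqActivity ρ β x i j (TriConfig.rep 1 W)) *
      (1 + plaqActivity ρ β x i j (TriConfig.rep 2 W)) - 1

/-- `h_p = f₀ (1+f₁)(1+f₂) + f₁ (1+f₂) + f₂` (telescoping form used for the zero mean). [folklore] -/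
theorem triActivity_eq (β : ℝ) (x : Literature.Probability.LatticeModels.Site d) (i j : Fin d) (W : TriConfig d G) :
    triActivity ρ β x i j W =
      plaqActivity ρ β x i j (TriConfig.rep 0 W) * (1 + plaqActivity ρ β x i j (TriConfig.rep 1 W)) *
          (1 + plaqActivity ρ β x i j (TriConfig.rep 2 W)) +
        plaqActivity ρ β x i j (TriConfig.rep 1 W) * (1 + plaqActivity ρ β x i j (TriConfig.rep 2 W)) +
        plaqActivity ρ β x i j (TriConfig.rep 2 W) := by
  unfold triActivity; ring

/-- `|(1+a)(1+b)(1+c) − 1| ≤ (1+K)³ − 1` when `|a|, |b|, |c| ≤ K`. [folklore] -/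
theorem abs_triple_sub_one_le {a b c K : ℝ} (ha : |a| ≤ K) (hb : |b| ≤ K) (hc : |c| ≤ K) :
    |(1 + a) * (1 + b) * (1 + c) - 1| ≤ (1 + K) ^ 3 - 1 := by
  have hK : 0 ≤ K := (abs_nonneg _).trans ha
  have h1 : (1 + a) * (1 + b) * (1 + c) - 1 = a + b + c + (a * b + a * c + b * c) + a * b * c := by ring
  rw [h1]
  have hab : |a * b| ≤ K * K := by rw [abs_mul]; exact mul_le_mul ha hb (abs_nonneg _) hK
  have hac : |a * c| ≤ K * K := by rw [abs_mul]; exact mul_le_mul ha hc (abs_nonneg _) hK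
  have hbc : |b * c| ≤ K * K := by rw [abs_mul]; exact mul_le_mul hb hc (abs_nonneg _) hK
  have habc : |a * b * c| ≤ K * K * K := by
    rw [abs_mul]; exact mul_le_mul hab hc (abs_nonneg _) (by positivity)
  calc |a + b + c + (a * b + a * c + b * c) + a * b * c|
      ≤ |a + b + c| + |a * b + a * c + b * c| + |a * b * c| :=
        (abs_add_le _ _).trans (add_le_add (abs_add_le _ _) le_rfl)
    _ ≤ (K + K + K) + (K * K + K * K + K * K) + K * K * K := by
        refine add_le_add (add_le_add ?_ ?_) habc
        · exact (abs_add_le _ _).trans (add_le_add ((abs_add_le _ _).trans (add_le_add ha hb)) hc)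
        · exact (abs_add_le _ _).trans (add_le_add ((abs_add_le _ _).trans (add_le_add hab hac)) hbc)
    _ = (1 + K) ^ 3 - 1 := by ring

/-- **Smallness of the tripled activity**, uniformly: `|h_p| ≤ (e^{2|β|B})³ − 1`. [folklore] -/
theorem abs_triActivity_le (hρ : Continuous ρ) :
    ∃ B : ℝ, 0 ≤ B ∧ ∀ (β : ℝ) (x : Literature.Probability.LatticeModels.Site d) (i j : Fin d) (W : TriConfig d G),
      |triActivity ρ β x i j W| ≤ Real.exp (2 * |β| * B) ^ 3 - 1 := by
  obtain ⟨B, hB0, hB⟩ := abs_plaqActivity_le ρ hρ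
  refine ⟨B, hB0, fun β x i j W => ?_⟩
  have h := abs_triple_sub_one_le (hB β x i j (TriConfig.rep 0 W)) (hB β x i j (TriConfig.rep 1 W))
    (hB β x i j (TriConfig.rep 2 W))
  rw [add_sub_cancel] at h
  exact h

/-- `h_p` is measurable. [folklore] -/
theorem measurable_triActivity (hρ : Continuous ρ) (β : ℝ) (x : Literature.Probability.LatticeModels.Site d)
    (i j : Fin d) : Measurable (triActivity ρ β x i j : TriConfig d G → ℝ) := by
  unfold triActivity
  exact (((((measurable_plaqActivity ρ hρ β x i j).comp (TriConfig.measurable_rep 0)).const_add 1).mul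
    (((measurable_plaqActivity ρ hρ β x i j).comp (TriConfig.measurable_rep 1)).const_add 1)).mul
    (((measurable_plaqActivity ρ hρ β x i j).comp (TriConfig.measurable_rep 2)).const_add 1)).sub_const 1

/-- `h_p` depends only on the tripled bonds of `p`. [folklore] -/
theorem dependsOn_triActivity (β : ℝ) (p : ZdPlaquette d) :
    DependsOn (triActivity ρ β p.1 p.2.1.1 p.2.1.2 : TriConfig d G → ℝ)
      {e : TriEdge d | e.1 ∈ plaquetteEdges p} := by
  intro W W' h
  unfold triActivity
  have hk : ∀ k : Fin 3, plaqActivity ρ β p.1 p.2.1.1 p.2.1.2 (TriConfig.rep k W) =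
      plaqActivity ρ β p.1 p.2.1.1 p.2.1.2 (TriConfig.rep k W') := fun k =>
    dependsOn_plaqActivity ρ β p fun e he => h (e, k) (by exact Finset.mem_coe.1 he)
  rw [hk 0, hk 1, hk 2]

end Activity

/-! ## §4 The kernel, the product of tripled activities, the expansion term, the tripled Gibbs factor -/

section Terms

variable {d N : ℕ} {G : Type*} [Group G] [TopologicalSpace G] [IsTopologicalGroup G]
  [CompactSpace G] [MeasurableSpace G] [BorelSpace G] (ρ : G →* Matrix (Fin N) (Fin N) ℂ)

/-- The product of tripled activities over a plaquette set, `h_Q = ∏_{p ∈ Q} h_p`. [folklore] -/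
def triActivityProd (β : ℝ) (Q : Finset (ZdPlaquette d)) (W : TriConfig d G) : ℝ :=
  ∏ p ∈ Q, triActivity ρ β p.1 p.2.1.1 p.2.1.2 W

/-- The third-cumulant kernel `(F₁(U⁰) − F₁(U¹)) (F₂(U⁰) − F₂(U²)) (F₃(U⁰) − F₃(U¹))`: its expectation under the
tripled Gibbs measure is `κ₃(F₁, F₂, F₃)`. [folklore] -/
def triKernel (F₁ F₂ F₃ : ZdGaugeConfig d G → ℝ) (W : TriConfig d G) : ℝ :=
  (F₁ (TriConfig.rep 0 W) - F₁ (TriConfig.rep 1 W)) * (F₂ (TriConfig.rep 0 W) - F₂ (TriConfig.rep 2 W)) *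
    (F₃ (TriConfig.rep 0 W) - F₃ (TriConfig.rep 1 W))

/-- The expansion term `I₃(Q) = ∫ K · ∏_{p ∈ Q} h_p d(ν⊗ν⊗ν)`. [folklore] -/
def triExpansionTerm (β : ℝ) (F₁ F₂ F₃ : ZdGaugeConfig d G → ℝ) (Q : Finset (ZdPlaquette d)) : ℝ :=
  ∫ W, triKernel F₁ F₂ F₃ W * triActivityProd ρ β Q W ∂triHaar d G

/-- The tripled Gibbs factor `W̃(U⁰) W̃(U¹) W̃(U²) = ∏_p (1 + h_p)`. [folklore] -/
def triGibbs (β : ℝ) (Λ : Finset (Literature.Probability.LatticeModels.Site d)) (W : TriConfig d G) : ℝ :=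
  gibbsFactor ρ β Λ (TriConfig.rep 0 W) * gibbsFactor ρ β Λ (TriConfig.rep 1 W) *
    gibbsFactor ρ β Λ (TriConfig.rep 2 W)

variable {ρ}

/-- `h_Q` is measurable. [folklore] -/
theorem measurable_triActivityProd (hρ : Continuous ρ) (β : ℝ) (Q : Finset (ZdPlaquette d)) :
    Measurable (triActivityProd ρ β Q : TriConfig d G → ℝ) := by
  unfold triActivityProd
  exact Finset.measurable_prod _ fun p _ => measurable_triActivity ρ hρ β _ _ _

omit [Group G] [TopologicalSpace G] [IsTopologicalGroup G] [CompactSpace G] [BorelSpace G] in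
/-- The kernel is measurable. [folklore] -/
theorem measurable_triKernel {F₁ F₂ F₃ : ZdGaugeConfig d G → ℝ} (h₁ : Measurable F₁) (h₂ : Measurable F₂)
    (h₃ : Measurable F₃) : Measurable (triKernel F₁ F₂ F₃ : TriConfig d G → ℝ) := by
  unfold triKernel
  exact (((h₁.comp (TriConfig.measurable_rep 0)).sub (h₁.comp (TriConfig.measurable_rep 1))).mul
    ((h₂.comp (TriConfig.measurable_rep 0)).sub (h₂.comp (TriConfig.measurable_rep 2)))).mul
    ((h₃.comp (TriConfig.measurable_rep 0)).sub (h₃.comp (TriConfig.measurable_rep 1)))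

/-- `|h_Q| ≤ K^{#Q}` when `|h_p| ≤ K`. [folklore] -/
theorem abs_triActivityProd_le {β K : ℝ}
    (hK : ∀ (x : Literature.Probability.LatticeModels.Site d) (i j : Fin d) (W : TriConfig d G),
      |triActivity ρ β x i j W| ≤ K)
    (Q : Finset (ZdPlaquette d)) (W : TriConfig d G) : |triActivityProd ρ β Q W| ≤ K ^ Q.card := by
  unfold triActivityProd
  rw [Finset.abs_prod]
  calc ∏ p ∈ Q, |triActivity ρ β p.1 p.2.1.1 p.2.1.2 W| ≤ ∏ _p ∈ Q, K :=
        Finset.prod_le_prod (fun p _ => abs_nonneg _) fun p _ => hK _ _ _ W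
    _ = K ^ Q.card := Finset.prod_const K

omit [Group G] [TopologicalSpace G] [IsTopologicalGroup G] [CompactSpace G] [MeasurableSpace G]
  [BorelSpace G] in
/-- `|K| ≤ 8 M₁ M₂ M₃`. [folklore] -/
theorem abs_triKernel_le {F₁ F₂ F₃ : ZdGaugeConfig d G → ℝ} {M₁ M₂ M₃ : ℝ} (h₁ : ∀ U, |F₁ U| ≤ M₁)
    (h₂ : ∀ U, |F₂ U| ≤ M₂) (h₃ : ∀ U, |F₃ U| ≤ M₃) (W : TriConfig d G) :
    |triKernel F₁ F₂ F₃ W| ≤ 8 * M₁ * M₂ * M₃ := by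
  unfold triKernel
  rw [abs_mul, abs_mul]
  have hM₁ : 0 ≤ M₁ := (abs_nonneg _).trans (h₁ (TriConfig.rep 0 W))
  have hM₂ : 0 ≤ M₂ := (abs_nonneg _).trans (h₂ (TriConfig.rep 0 W))
  have e1 : |F₁ (TriConfig.rep 0 W) - F₁ (TriConfig.rep 1 W)| ≤ 2 * M₁ :=
    (abs_sub _ _).trans (by linarith [h₁ (TriConfig.rep 0 W), h₁ (TriConfig.rep 1 W)])
  have e2 : |F₂ (TriConfig.rep 0 W) - F₂ (TriConfig.rep 2 W)| ≤ 2 * M₂ :=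
    (abs_sub _ _).trans (by linarith [h₂ (TriConfig.rep 0 W), h₂ (TriConfig.rep 2 W)])
  have e3 : |F₃ (TriConfig.rep 0 W) - F₃ (TriConfig.rep 1 W)| ≤ 2 * M₃ :=
    (abs_sub _ _).trans (by linarith [h₃ (TriConfig.rep 0 W), h₃ (TriConfig.rep 1 W)])
  calc |F₁ (TriConfig.rep 0 W) - F₁ (TriConfig.rep 1 W)| * |F₂ (TriConfig.rep 0 W) - F₂ (TriConfig.rep 2 W)| *
        |F₃ (TriConfig.rep 0 W) - F₃ (TriConfig.rep 1 W)| ≤ 2 * M₁ * (2 * M₂) * (2 * M₃) :=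
        mul_le_mul (mul_le_mul e1 e2 (abs_nonneg _) (by linarith)) e3 (abs_nonneg _) (by positivity)
    _ = 8 * M₁ * M₂ * M₃ := by ring

/-- `h_Q` depends only on the tripled bonds of the plaquettes of `Q`. [folklore] -/
theorem dependsOn_triActivityProd (β : ℝ) (Q : Finset (ZdPlaquette d)) :
    DependsOn (triActivityProd ρ β Q : TriConfig d G → ℝ)
      {e : TriEdge d | ∃ p ∈ Q, e.1 ∈ plaquetteEdges p} := by
  intro W W' h
  unfold triActivityProd
  refine Finset.prod_congr rfl fun p hp => dependsOn_triActivity ρ β p fun e he => h e ?_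
  exact ⟨p, hp, he⟩

omit [Group G] [TopologicalSpace G] [IsTopologicalGroup G] [CompactSpace G] [MeasurableSpace G]
  [BorelSpace G] in
/-- The kernel depends only on the tripled bonds of `E₁ ∪ E₂ ∪ E₃`. [folklore] -/
theorem dependsOn_triKernel {F₁ F₂ F₃ : ZdGaugeConfig d G → ℝ} {E₁ E₂ E₃ : Set (ZdEdge d)}
    (hF₁ : DependsOn F₁ E₁) (hF₂ : DependsOn F₂ E₂) (hF₃ : DependsOn F₃ E₃) :
    DependsOn (triKernel F₁ F₂ F₃ : TriConfig d G → ℝ) {e : TriEdge d | e.1 ∈ E₁ ∨ e.1 ∈ E₂ ∨ e.1 ∈ E₃} := by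
  intro W W' h
  have e1 : ∀ k : Fin 3, F₁ (TriConfig.rep k W) = F₁ (TriConfig.rep k W') := fun k =>
    hF₁ fun e he => h (e, k) (Or.inl he)
  have e2 : ∀ k : Fin 3, F₂ (TriConfig.rep k W) = F₂ (TriConfig.rep k W') := fun k =>
    hF₂ fun e he => h (e, k) (Or.inr (Or.inl he))
  have e3 : ∀ k : Fin 3, F₃ (TriConfig.rep k W) = F₃ (TriConfig.rep k W') := fun k =>
    hF₃ fun e he => h (e, k) (Or.inr (Or.inr he))
  unfold triKernel
  rw [e1 0, e1 1, e2 0, e2 2, e3 0, e3 1]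

/-- A bounded measurable function on the tripled configuration space is integrable. [folklore] -/
theorem integrable_of_abs_le {Ψ : TriConfig d G → ℝ} (hm : Measurable Ψ) {M : ℝ} (hb : ∀ W, |Ψ W| ≤ M) :
    Integrable Ψ (triHaar d G) :=
  Integrable.of_bound hm.aestronglyMeasurable M (ae_of_all _ fun W => by rw [Real.norm_eq_abs]; exact hb W)

/-- `W̃(U⁰) W̃(U¹) W̃(U²) = ∏_p (1 + h_p) = Σ_{Q ⊆ Λ'} h_Q`. [folklore] -/
theorem triGibbs_eq_sum (β : ℝ) (Λ : Finset (Literature.Probability.LatticeModels.Site d)) (W : TriConfig d G) :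
    triGibbs ρ β Λ W = ∑ Q ∈ (plaqSet Λ).powerset, triActivityProd ρ β Q W := by
  unfold triGibbs gibbsFactor triActivityProd
  rw [← Finset.prod_mul_distrib, ← Finset.prod_mul_distrib, ← Finset.prod_one_add]
  refine Finset.prod_congr rfl fun p _ => ?_
  unfold triActivity
  ring

end Terms

end Summit.QuantumFields.YangMills.Cruxes.NT.StrongCouplingRung

end
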